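import Literature.Probability.Percolation.FKLoopNestingMeasureExistence
import Literature.Probability.Percolation.BondPercolationSymmetry
import HarnessLib

/-!
# The measure in DKLM Corollary 10 is invariant under the symmetries of `ℤ²`

Companion of `Literature.Probability.Percolation.FKLoopNestingGaussianLimit` (the named fact
`dklm2026_corollary10`, Duminil-Copin–Kozlowski–Lammers–Manolescu, arXiv:2603.06268, Cor. 10),
of `FKLoopNestingMeasureUnique` (the measure `P` in its hypothesis — a free infinite-volume
random-cluster limit `IsFreeRandomClusterLimit p q P` on `ℤ²` — is unique) and of
`FKLoopNestingMeasureExistence` (it exists for `p ∈ [0,1]`, `q ≥ 1`: Grimmett's Thm. (4.19)(a)).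
Here we PROVE the second item of the same theorem, on `ℤ²`:

> **Theorem (4.19)(b)** (Grimmett 2006, *Automorphism-invariance*). Let `p ∈ [0,1]`,
> `q ∈ [1,∞)`. The probability measure `φ⁰_{p,q}` is automorphism-invariant.

in the tree's vocabulary, for the two kinds of automorphisms of the square lattice that generate
`Aut(ℤ²)` ("Each automorphism of `𝕃^d` is a combination of a translation `τ` and an element
`σ ∈ 𝒞`", the automorphisms fixing the origin; Grimmett 2006, proof of Thm. (4.19)(b)):

* `IsFreeRandomClusterLimit.map_relabel_shift` — **translation invariance**: for `p ∈ [0,1]`,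
  `q ≥ 1` and `v ∈ ℤ²`, the image of `P` under the shift of configurations `ω ↦ ω + v`
  (`BondConfig.relabel (sym2Equiv (Site.shift v))`, as in `bondPercolation_map_shift`) is `P`;
* `IsFreeRandomClusterLimit.map_relabel_signedPerm` — **invariance under the symmetries of the
  box** (the signed coordinate permutations `Site.signedPerm π ε`, i.e. the dihedral group of
  the square, which fix the origin and preserve every `Λ_n`), for `p ∈ [0,1]`, `q > 0`;

with the applied forms `measure_preimage_relabel_*` (`P{ω | g ω ∈ A} = P(A)` for every event),
`integral_comp_relabel_*` (`∫ f (g ω) dP = ∫ f dP`), `measurePreserving_relabel_*`, and the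
specialisations to the self-dual point `p = p_sd(q)`, `q ∈ [1, 4]` of Cor. 10
(`*_rcSelfDualPoint`, no side condition left). Translation invariance of `φ_{ℤ²,q}` is the
property used (module docstring of `FKLoopNestingGaussianLimit`, "by translation invariance of
the infinite-volume measure") to compare the lattice conventions of the tree and of the source
for Cor. 10 up to a sub-lattice offset.

## Proof (Grimmett 2006, proof of Thm. (4.19)(b), p. 78, assembled from the tree)

* **Increasing cylinder events determine the measure** (`ext_of_cylinderEvent_self`): the events
  `{all pairs of E₀ open} = cylinderEvent E₀ E₀` form a π-system generating the product
  σ-algebra (every cylinder event is a finite intersection of such events and complements of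
  such events), so two probability measures agreeing on them are equal — the tree's rendering of
  "the collection of all such events `B` is convergence-determining".
* **Translations** (`IsFreeRandomClusterLimit.measureReal_cylinderEvent_self_map_shift`): by the
  invariance of the finite-volume measures under graph isomorphisms
  (`rcMeasure_real_preimage_relabel`, here through `finsetGraphIso (zdShiftIso ·)`),
  `φ⁰_{Λ_N}((E₀ + v) open) = φ⁰_{Λ_N - v}(E₀ open)`, and by the monotonicity of the free
  measures in the domain — Grimmett's (4.24), `rcMeasure_real_free_le_restrict`, from the free
  domain Markov property and positive association — this is sandwiched between
  `φ⁰_{Λ_{N-‖v‖}}(E₀ open)` and `φ⁰_{Λ_{N+‖v‖}}(E₀ open)` (`Λ_{N-‖v‖} ⊆ Λ_N - v ⊆ Λ_{N+‖v‖}`), both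
  of which tend to `P(E₀ open)`; hence `P((E₀ + v) open) = P(E₀ open)` (the pattern of the
  tree's `freeEdgeDensity_map_add`, one edge, extended to finite sets of edges).
* **Symmetries of the box** (`IsFreeRandomClusterLimit.measureReal_cylinderEvent_self_map_signedPerm`):
  a signed coordinate permutation `σ` maps `Λ_N` onto itself, so `φ⁰_{Λ_N}(σE₀ open) =
  φ⁰_{Λ_N}(E₀ open)` exactly, for every `N`, and the limits agree.

Everything is proved; no named fact is introduced. Not covered: the classification
"`Aut(ℤ²)` = translations ⋊ signed permutations" itself (each generator is treated), the wired
measure `φ¹` (no wired infinite-volume limit structure in the tree's Cor. 10 vocabulary), and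
parts (c)–(d) of Thm. (4.19).

## References

* G. Grimmett, *The Random-Cluster Model*, Springer 2006: §4.3 (automorphisms, translations
  `τ_x`), Thm. (4.19)(b) and its proof (p. 78), eq. (4.24); §4.1 (cylinder σ-field). [Grimmett2006]
* H. Duminil-Copin, K. K. Kozlowski, P. Lammers, I. Manolescu, arXiv:2603.06268 (2026), Cor. 10
  and §5 p. 37 (the lattice conventions). [DuminilCopinKozlowskiLammersManolescu2026]
-/

noncomputable section

open MeasureTheory Set Filter
open scoped Topology

namespace Literature.Probability.Percolation

open LatticeModels

/-! ### Increasing cylinder events determine a probability measure -/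

/-- `cylinderEvent E₀ E₀` is the increasing cylinder event "every pair of `E₀` is open".
[cite: Grimmett2006, §4.1] -/
theorem mem_cylinderEvent_self_iff {E₀ : Finset (Sym2 (Site 2))} {ω : BondConfig (Site 2)} :
    ω ∈ cylinderEvent E₀ E₀ ↔ ∀ e ∈ E₀, e ∈ ω := by
  rw [mem_cylinderEvent_iff]
  exact forall₂_congr fun e he => iff_true_right he

/-- Two "all open" events intersect in the "all open" event of the union. [folklore] -/
theorem cylinderEvent_self_inter [DecidableEq (Sym2 (Site 2))] (E₀ E₁ : Finset (Sym2 (Site 2))) :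
    cylinderEvent E₀ E₀ ∩ cylinderEvent E₁ E₁ = cylinderEvent (E₀ ∪ E₁) (E₀ ∪ E₁) := by
  ext ω
  simp only [Set.mem_inter_iff, mem_cylinderEvent_self_iff, Finset.forall_mem_union]

/-- **The increasing cylinder events form a π-system.** [cite: Grimmett2006, §4.1] -/
theorem isPiSystem_cylinderEvent_self :
    IsPiSystem (Set.range fun E₀ : Finset (Sym2 (Site 2)) => cylinderEvent E₀ E₀) := by
  classical
  rintro _ ⟨E₀, rfl⟩ _ ⟨E₁, rfl⟩ -
  exact ⟨E₀ ∪ E₁, (cylinderEvent_self_inter E₀ E₁).symm⟩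

/-- **The increasing cylinder events generate the product σ-algebra** on `BondConfig (Site 2)`:
every cylinder event is a finite intersection of coordinate events `{e open} = cylinderEvent {e} {e}`
and of their complements. [cite: Grimmett2006, §4.1] -/
theorem generateFrom_cylinderEvent_self :
    MeasurableSpace.generateFrom (Set.range fun E₀ : Finset (Sym2 (Site 2)) => cylinderEvent E₀ E₀) =
      (Set.instMeasurableSpace : MeasurableSpace (BondConfig (Site 2))) := by
  refine le_antisymm (MeasurableSpace.generateFrom_le ?_) ?_
  · rintro _ ⟨E₀, rfl⟩
    exact measurableSet_cylinderEvent E₀ E₀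
  · rw [← generateFrom_cylinderEvent]
    refine MeasurableSpace.generateFrom_le ?_
    rintro _ ⟨⟨E₀, S⟩, rfl⟩
    have h : cylinderEvent E₀ S = ⋂ e ∈ E₀, {ω : BondConfig (Site 2) | e ∈ ω ↔ e ∈ S} := by
      ext ω
      simp only [mem_cylinderEvent_iff, Set.mem_iInter, Set.mem_setOf_eq]
    dsimp only
    rw [h]
    refine Finset.measurableSet_biInter E₀ fun e _ => ?_
    have he : MeasurableSet[MeasurableSpace.generateFrom
        (Set.range fun E₀ : Finset (Sym2 (Site 2)) => cylinderEvent E₀ E₀)]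
        {ω : BondConfig (Site 2) | e ∈ ω} := by
      rw [setOf_mem_eq_cylinderEvent]
      exact MeasurableSpace.measurableSet_generateFrom ⟨{e}, rfl⟩
    by_cases heS : e ∈ S
    · simp only [heS, iff_true]
      exact he
    · simp only [heS, iff_false]
      rw [← Set.compl_setOf]
      exact he.compl

/-- **Increasing cylinder events determine a probability measure on `ℤ²`-bond configurations**:
two probability measures giving every event "all pairs of `E₀` open" the same mass are equal
(Grimmett: "the collection of all such events `B` is convergence-determining").
[cite: Grimmett2006, Thm. (4.19), proof of (a)] -/
theorem ext_of_cylinderEvent_self {P P' : Measure (BondConfig (Site 2))} [IsProbabilityMeasure P]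
    [IsProbabilityMeasure P']
    (h : ∀ E₀ : Finset (Sym2 (Site 2)), P (cylinderEvent E₀ E₀) = P' (cylinderEvent E₀ E₀)) :
    P = P' := by
  refine ext_of_generate_finite _ generateFrom_cylinderEvent_self.symm isPiSystem_cylinderEvent_self
    ?_ (by rw [measure_univ, measure_univ])
  rintro _ ⟨E₀, rfl⟩
  exact h E₀

/-! ### Transport of cylinder events under relabellings of `ℤ²` -/

/-- Preimage of a cylinder event under the relabelling of configurations by a bijection of
pairs `e2` (`ω ↦ e2 '' ω`): the cylinder event of the pulled-back pair sets. [folklore] -/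
theorem relabel_preimage_cylinderEvent (e2 : Sym2 (Site 2) ≃ Sym2 (Site 2))
    (E₀ S : Finset (Sym2 (Site 2))) :
    BondConfig.relabel e2 ⁻¹' cylinderEvent E₀ S =
      cylinderEvent (E₀.map e2.symm.toEmbedding) (S.map e2.symm.toEmbedding) := by
  ext ω
  simp only [Set.mem_preimage, mem_cylinderEvent_iff, BondConfig.mem_relabel_iff,
    Finset.forall_mem_map]
  simp only [Equiv.coe_toEmbedding, Finset.mem_map_equiv, Equiv.symm_symm,
    Equiv.apply_symm_apply]

/-- Transport of the event "all pairs of `E₀` open" on finite pieces `S → S' = g(S)` under an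
automorphism `g` of `ℤ²`: the preimage of the event for `g(E₀)` on `S'` is the event for `E₀`
on `S` (the tree's `relabel_preimage_eOpen`, one pair at a time). [cite: Grimmett2006, §4.3 (automorphism invariance)] -/
theorem relabel_preimage_pieceCylinderEvent_self (g : zdGraph 2 ≃g zdGraph 2)
    {S S' : Finset (Site 2)} (hS : ∀ x, x ∈ S' ↔ g.symm x ∈ S) (E₀ : Finset (Sym2 (Site 2))) :
    BondConfig.relabel (sym2Equiv (finsetGraphIso g hS).toEquiv) ⁻¹'
        pieceCylinderEvent S' (E₀.map (sym2Equiv g.toEquiv).toEmbedding)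
          (E₀.map (sym2Equiv g.toEquiv).toEmbedding) =
      pieceCylinderEvent S E₀ E₀ := by
  rw [pieceCylinderEvent_eq_iInter_eOpen S' (Finset.Subset.refl _),
    pieceCylinderEvent_eq_iInter_eOpen S (Finset.Subset.refl _), Set.preimage_iInter₂]
  ext ω
  simp only [Set.mem_iInter, Finset.forall_mem_map]
  refine forall₂_congr fun e _ => ?_
  have h := relabel_preimage_eOpen g hS e
  rw [Set.ext_iff] at h
  have h' := h ω
  rw [Set.mem_preimage] at h'
  rw [← h', Set.mem_preimage]
  simp only [Equiv.coe_toEmbedding, sym2Equiv_apply]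
  rfl

/-- **Automorphism invariance of the free finite-volume probabilities of "all of `E₀` open"**:
`φ⁰_S(E₀ open) = φ⁰_{g S}(g E₀ open)` for an automorphism `g` of `ℤ²` with `S' = g(S)`.
[cite: Grimmett2006, §4.3 (automorphism invariance)] -/
theorem rcMeasure_real_pieceCylinderEvent_self_eq_of_iso (g : zdGraph 2 ≃g zdGraph 2)
    {S S' : Finset (Site 2)} (hS : ∀ x, x ∈ S' ↔ g.symm x ∈ S) {p q : ℝ}
    (hp : p ∈ Set.Icc (0 : ℝ) 1) (hq : 0 < q) (E₀ : Finset (Sym2 (Site 2))) :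
    (rcMeasure (finsetGraph (zdGraph 2) S) p q ∅).real (pieceCylinderEvent S E₀ E₀) =
      (rcMeasure (finsetGraph (zdGraph 2) S') p q ∅).real
        (pieceCylinderEvent S' (E₀.map (sym2Equiv g.toEquiv).toEmbedding)
          (E₀.map (sym2Equiv g.toEquiv).toEmbedding)) := by
  rw [← relabel_preimage_pieceCylinderEvent_self g hS E₀,
    rcMeasure_real_preimage_relabel (finsetGraphIso g hS) hp hq, Set.image_empty]

/-- **Monotonicity in the domain for "all of `E₀` open"** (Grimmett's (4.24)): for finite pieces
`Λ ⊆ Δ` of `ℤ²` containing the endpoints of the pairs of `E₀`, `p ∈ [0,1]`, `q ≥ 1`,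
`φ⁰_Λ(E₀ open) ≤ φ⁰_Δ(E₀ open)`. [cite: Grimmett2006, Thm. (4.19)(a), proof, eq. (4.24)] -/
theorem rcMeasure_real_pieceCylinderEvent_self_mono {Λ Δ : Finset (Site 2)} (h : Λ ⊆ Δ)
    {p q : ℝ} (hp : p ∈ Set.Icc (0 : ℝ) 1) (hq : 1 ≤ q) {E₀ : Finset (Sym2 (Site 2))}
    (hE : ∀ e ∈ E₀, ∀ z ∈ e, z ∈ Λ) :
    (rcMeasure (finsetGraph (zdGraph 2) Λ) p q ∅).real (pieceCylinderEvent Λ E₀ E₀) ≤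
      (rcMeasure (finsetGraph (zdGraph 2) Δ) p q ∅).real (pieceCylinderEvent Δ E₀ E₀) := by
  have hpre : finsetRestrict h ⁻¹' pieceCylinderEvent Λ E₀ E₀ = pieceCylinderEvent Δ E₀ E₀ := by
    rw [pieceCylinderEvent_eq_iInter_eOpen Λ (Finset.Subset.refl _),
      pieceCylinderEvent_eq_iInter_eOpen Δ (Finset.Subset.refl _), Set.preimage_iInter₂]
    exact Set.iInter₂_congr fun e he => finsetRestrict_preimage_eOpen h (hE e he)
  rw [← hpre]
  exact rcMeasure_real_free_le_restrict h hp hq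
    (isUpperSet_pieceCylinderEvent_of_subset Λ (Finset.Subset.refl _))

/-! ### Translations: the sandwich of shifted boxes -/

/-- The pair set `E₀ + v`, as the image of `E₀` under the embedding of pairs induced by the
translation `Site.shift v`, is `E₀` mapped by `e ↦ e.map (· + v)`. [folklore] -/
theorem map_sym2Equiv_shift_apply (v : Site 2) (e : Sym2 (Site 2)) :
    (sym2Equiv (Site.shift v)).toEmbedding e = e.map (· + v) := by
  rw [Equiv.coe_toEmbedding, sym2Equiv_apply]
  rfl

/-- Translating by `v` and then by `-v` is the identity on pair sets. [folklore] -/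
theorem map_shift_map_shift_neg (v : Site 2) (E₀ : Finset (Sym2 (Site 2))) :
    (E₀.map (sym2Equiv (Site.shift v)).toEmbedding).map
        (sym2Equiv (zdShiftIso (-v)).toEquiv).toEmbedding = E₀ := by
  rw [Finset.map_map]
  have hcomp : (sym2Equiv (Site.shift v)).toEmbedding.trans
      (sym2Equiv (zdShiftIso (-v)).toEquiv).toEmbedding = Function.Embedding.refl _ := by
    ext e
    simp only [Function.Embedding.trans_apply, Equiv.coe_toEmbedding, sym2Equiv_apply,
      Function.Embedding.refl_apply, Sym2.map_map]
    have hid : (⇑(zdShiftIso (-v)).toEquiv ∘ ⇑(Site.shift v)) = id := by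
      funext x
      simp only [Function.comp_apply, Site.shift_apply, id_eq]
      show x + v + -v = x
      abel
    rw [hid, Sym2.map_id, id_eq]
  rw [hcomp, Finset.map_refl]

/-- **`φ⁰_{Λ_N}((E₀ + v) open) = φ⁰_{Λ_N - v}(E₀ open)`** (automorphism invariance under the
translation `τ_{-v}`). [cite: Grimmett2006, §4.3 and proof of Thm. (4.19)(b)] -/
theorem rcFreeBoxMeasure_real_pieceCylinderEvent_map_shift (v : Site 2) {p q : ℝ}
    (hp : p ∈ Set.Icc (0 : ℝ) 1) (hq : 0 < q) (E₀ : Finset (Sym2 (Site 2))) (N : ℕ) :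
    (rcFreeBoxMeasure p q N).real
        (pieceCylinderEvent (box 2 N) (E₀.map (sym2Equiv (Site.shift v)).toEmbedding)
          (E₀.map (sym2Equiv (Site.shift v)).toEmbedding)) =
      (rcMeasure (finsetGraph (zdGraph 2)
          (Finset.Icc (fun i => -(N : ℤ) + (-v) i) (fun i => (N : ℤ) + (-v) i))) p q ∅).real
        (pieceCylinderEvent (Finset.Icc (fun i => -(N : ℤ) + (-v) i) (fun i => (N : ℤ) + (-v) i))
          E₀ E₀) := by
  rw [rcFreeBoxMeasure, rcMeasure_real_pieceCylinderEvent_self_eq_of_iso (zdShiftIso (-v))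
    (mem_icc_shift_iff N (-v)) hp hq, map_shift_map_shift_neg]

/-- Sandwich, lower side: `φ⁰_{Λ_{N-‖v‖}}(E₀ open) ≤ φ⁰_{Λ_N}((E₀ + v) open)` once the pairs of
`E₀` lie in `Λ_{N-‖v‖}`. [cite: Grimmett2006, Thm. (4.19)(b), proof, via eq. (4.24)] -/
theorem rcFreeBoxMeasure_real_pieceCylinderEvent_sub_le_map_shift (v : Site 2) {p q : ℝ}
    (hp : p ∈ Set.Icc (0 : ℝ) 1) (hq : 1 ≤ q) {E₀ : Finset (Sym2 (Site 2))} {N : ℕ}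
    (hN : E₀.sup pairRad + siteRad v ≤ N) :
    (rcFreeBoxMeasure p q (N - siteRad v)).real
        (pieceCylinderEvent (box 2 (N - siteRad v)) E₀ E₀) ≤
      (rcFreeBoxMeasure p q N).real
        (pieceCylinderEvent (box 2 N) (E₀.map (sym2Equiv (Site.shift v)).toEmbedding)
          (E₀.map (sym2Equiv (Site.shift v)).toEmbedding)) := by
  have hq0 : 0 < q := one_pos.trans_le hq
  rw [rcFreeBoxMeasure_real_pieceCylinderEvent_map_shift v hp hq0 E₀ N, rcFreeBoxMeasure]
  have hsub := box_sub_subset_icc_shift (d := 2) (n := N) (v := -v) (by rw [siteRad_neg]; omega)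
  rw [siteRad_neg] at hsub
  refine rcMeasure_real_pieceCylinderEvent_self_mono hsub hp hq fun e he => ?_
  have h1 : pairRad e ≤ E₀.sup pairRad := Finset.le_sup (f := pairRad) he
  exact mem_box_of_pairRad_le (by omega)

/-- Sandwich, upper side: `φ⁰_{Λ_N}((E₀ + v) open) ≤ φ⁰_{Λ_{N+‖v‖}}(E₀ open)` once the pairs of
`E₀ + v` lie in `Λ_N`. [cite: Grimmett2006, Thm. (4.19)(b), proof, via eq. (4.24)] -/
theorem rcFreeBoxMeasure_real_pieceCylinderEvent_map_shift_le_add (v : Site 2) {p q : ℝ}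
    (hp : p ∈ Set.Icc (0 : ℝ) 1) (hq : 1 ≤ q) {E₀ : Finset (Sym2 (Site 2))} {N : ℕ}
    (hN : (E₀.map (sym2Equiv (Site.shift v)).toEmbedding).sup pairRad ≤ N) :
    (rcFreeBoxMeasure p q N).real
        (pieceCylinderEvent (box 2 N) (E₀.map (sym2Equiv (Site.shift v)).toEmbedding)
          (E₀.map (sym2Equiv (Site.shift v)).toEmbedding)) ≤
      (rcFreeBoxMeasure p q (N + siteRad v)).real
        (pieceCylinderEvent (box 2 (N + siteRad v)) E₀ E₀) := by
  have hq0 : 0 < q := one_pos.trans_le hq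
  rw [rcFreeBoxMeasure_real_pieceCylinderEvent_map_shift v hp hq0 E₀ N, rcFreeBoxMeasure]
  have hsub := icc_shift_subset_box_add (d := 2) N (-v)
  rw [siteRad_neg] at hsub
  refine rcMeasure_real_pieceCylinderEvent_self_mono hsub hp hq fun e he => ?_
  refine mem_icc_neg_shift_of_pairRad_map_add_le ?_
  have h1 : pairRad ((sym2Equiv (Site.shift v)).toEmbedding e) ≤
      (E₀.map (sym2Equiv (Site.shift v)).toEmbedding).sup pairRad :=
    Finset.le_sup (f := pairRad) (Finset.mem_map_of_mem _ he)
  rw [map_sym2Equiv_shift_apply] at h1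
  exact h1.trans hN

/-! ### Grimmett 2006, Thm. (4.19)(b): translation invariance of the free limit -/

section Invariance

variable {p q : ℝ} {P : Measure (BondConfig (Site 2))}

/-- **Translation invariance on increasing cylinder events**: for a free infinite-volume
random-cluster limit `P` (`p ∈ [0,1]`, `q ≥ 1`), `P((E₀ + v) open) = P(E₀ open)` — both box
probabilities converge, and `φ⁰_{Λ_N}((E₀ + v) open)` is sandwiched between
`φ⁰_{Λ_{N∓‖v‖}}(E₀ open)`. [cite: Grimmett2006, Thm. (4.19)(b), proof] -/
theorem IsFreeRandomClusterLimit.measureReal_cylinderEvent_self_map_shift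
    (hP : IsFreeRandomClusterLimit p q P) (hp : p ∈ Set.Icc (0 : ℝ) 1) (hq : 1 ≤ q)
    (v : Site 2) (E₀ : Finset (Sym2 (Site 2))) :
    P.real (cylinderEvent (E₀.map (sym2Equiv (Site.shift v)).toEmbedding)
        (E₀.map (sym2Equiv (Site.shift v)).toEmbedding)) =
      P.real (cylinderEvent E₀ E₀) := by
  -- the two box sequences `a_N = φ⁰_{Λ_N}(E₀ open)`, `b_N = φ⁰_{Λ_N}((E₀ + v) open)`
  let a : ℕ → ℝ := fun n => (rcFreeBoxMeasure p q n).real (pieceCylinderEvent (box 2 n) E₀ E₀)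
  let b : ℕ → ℝ := fun n => (rcFreeBoxMeasure p q n).real
    (pieceCylinderEvent (box 2 n) (E₀.map (sym2Equiv (Site.shift v)).toEmbedding)
      (E₀.map (sym2Equiv (Site.shift v)).toEmbedding))
  have hlim : Tendsto a atTop (𝓝 (P.real (cylinderEvent E₀ E₀))) := hP.tendsto_cylinder E₀ E₀
  have hlim' : Tendsto b atTop (𝓝 (P.real
      (cylinderEvent (E₀.map (sym2Equiv (Site.shift v)).toEmbedding)
        (E₀.map (sym2Equiv (Site.shift v)).toEmbedding)))) :=
    hP.tendsto_cylinder _ _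
  -- the shifted sequences are kept in the syntactic form `a ∘ (· ∓ ‖v‖)` produced by
  -- `Tendsto.comp` (unfolding the composition against `a` is expensive for the unifier)
  have hlo : Tendsto (a ∘ fun N => N - siteRad v) atTop (𝓝 (P.real (cylinderEvent E₀ E₀))) :=
    hlim.comp (tendsto_sub_atTop_nat (siteRad v))
  have hup : Tendsto (a ∘ fun N => N + siteRad v) atTop (𝓝 (P.real (cylinderEvent E₀ E₀))) :=
    hlim.comp (tendsto_add_atTop_nat (siteRad v))
  have hle₁ : ∀ᶠ N in atTop, (a ∘ fun N => N - siteRad v) N ≤ b N := by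
    filter_upwards [eventually_ge_atTop (E₀.sup pairRad + siteRad v)] with N hN
    rw [Function.comp_apply]
    exact rcFreeBoxMeasure_real_pieceCylinderEvent_sub_le_map_shift v hp hq hN
  have hle₂ : ∀ᶠ N in atTop, b N ≤ (a ∘ fun N => N + siteRad v) N := by
    filter_upwards [eventually_ge_atTop
      ((E₀.map (sym2Equiv (Site.shift v)).toEmbedding).sup pairRad)] with N hN
    rw [Function.comp_apply]
    exact rcFreeBoxMeasure_real_pieceCylinderEvent_map_shift_le_add v hp hq hN
  exact tendsto_nhds_unique hlim' (tendsto_of_tendsto_of_tendsto_of_le_of_le' hlo hup hle₁ hle₂)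

/-- The inverse of the pair bijection of the translation by `v` is that of the translation by
`-v`. [folklore] -/
theorem sym2Equiv_shift_symm (v : Site 2) :
    (sym2Equiv (Site.shift v)).symm = sym2Equiv (Site.shift (-v)) := by
  rw [sym2Equiv_symm]
  congr 1
  exact Equiv.ext fun x => by rw [Site.shift_symm_apply, Site.shift_apply, sub_eq_add_neg]

/-- **Grimmett 2006, Thm. (4.19)(b), translations, free measure on `ℤ²`**: for `p ∈ [0,1]`,
`q ≥ 1` and a free infinite-volume random-cluster limit `P`, the image of `P` under the shift
`ω ↦ ω + v` of configurations (`s(x,y) ↦ s(x+v, y+v)`) is `P`, for every `v ∈ ℤ²`.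
[cite: Grimmett2006, Thm. (4.19)(b)] -/
theorem IsFreeRandomClusterLimit.map_relabel_shift (hP : IsFreeRandomClusterLimit p q P)
    (hp : p ∈ Set.Icc (0 : ℝ) 1) (hq : 1 ≤ q) (v : Site 2) :
    P.map (BondConfig.relabel (sym2Equiv (Site.shift v))) = P := by
  haveI := hP.isProbabilityMeasure
  haveI : IsProbabilityMeasure (P.map (BondConfig.relabel (sym2Equiv (Site.shift v)))) :=
    Measure.isProbabilityMeasure_map (MeasurableEquiv.measurable _).aemeasurable
  refine ext_of_cylinderEvent_self fun E₀ => ?_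
  rw [MeasurableEquiv.map_apply, relabel_preimage_cylinderEvent, sym2Equiv_shift_symm]
  have h := hP.measureReal_cylinderEvent_self_map_shift hp hq (-v) E₀
  rw [measureReal_def, measureReal_def,
    ENNReal.toReal_eq_toReal_iff' (measure_ne_top _ _) (measure_ne_top _ _)] at h
  exact h

/-- Applied form: `P{ω | ω + v ∈ A} = P(A)` for every event `A`. [cite: Grimmett2006, Thm. (4.19)(b)] -/
theorem IsFreeRandomClusterLimit.measure_preimage_relabel_shift
    (hP : IsFreeRandomClusterLimit p q P) (hp : p ∈ Set.Icc (0 : ℝ) 1) (hq : 1 ≤ q)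
    (v : Site 2) (A : Set (BondConfig (Site 2))) :
    P (BondConfig.relabel (sym2Equiv (Site.shift v)) ⁻¹' A) = P A := by
  conv_rhs => rw [← hP.map_relabel_shift hp hq v]
  rw [MeasurableEquiv.map_apply]

/-- The shift `ω ↦ ω + v` is measure preserving for `P`. [cite: Grimmett2006, Thm. (4.19)(b)] -/
theorem IsFreeRandomClusterLimit.measurePreserving_relabel_shift
    (hP : IsFreeRandomClusterLimit p q P) (hp : p ∈ Set.Icc (0 : ℝ) 1) (hq : 1 ≤ q)
    (v : Site 2) :
    MeasurePreserving (BondConfig.relabel (sym2Equiv (Site.shift v))) P P :=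
  ⟨MeasurableEquiv.measurable _, hP.map_relabel_shift hp hq v⟩

/-- Integrated form: `∫ f(ω + v) dP(ω) = ∫ f dP` for every `f`. [cite: Grimmett2006, Thm. (4.19)(b)] -/
theorem IsFreeRandomClusterLimit.integral_comp_relabel_shift {E : Type*} [NormedAddCommGroup E]
    [NormedSpace ℝ E] (hP : IsFreeRandomClusterLimit p q P) (hp : p ∈ Set.Icc (0 : ℝ) 1)
    (hq : 1 ≤ q) (v : Site 2) (f : BondConfig (Site 2) → E) :
    ∫ ω, f (BondConfig.relabel (sym2Equiv (Site.shift v)) ω) ∂P = ∫ ω, f ω ∂P := by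
  rw [← integral_map_equiv, hP.map_relabel_shift hp hq v]

/-! ### Grimmett 2006, Thm. (4.19)(b): invariance under the symmetries of the box -/

/-- **Invariance on increasing cylinder events under signed coordinate permutations**: a
symmetry `σ` of `ℤ²` fixing the origin maps every box `Λ_N` onto itself, so
`φ⁰_{Λ_N}(σE₀ open) = φ⁰_{Λ_N}(E₀ open)` for all `N`, and `P(σE₀ open) = P(E₀ open)` in the
limit. [cite: Grimmett2006, Thm. (4.19)(b), proof ("every element of 𝒞 preserves boxes Λ_n")] -/
theorem IsFreeRandomClusterLimit.measureReal_cylinderEvent_self_map_signedPerm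
    (hP : IsFreeRandomClusterLimit p q P) (hp : p ∈ Set.Icc (0 : ℝ) 1) (hq : 0 < q)
    (π : Equiv.Perm (Fin 2)) (ε : Fin 2 → ℤˣ) (E₀ : Finset (Sym2 (Site 2))) :
    P.real (cylinderEvent (E₀.map (sym2Equiv (Site.signedPerm π ε)).toEmbedding)
        (E₀.map (sym2Equiv (Site.signedPerm π ε)).toEmbedding)) =
      P.real (cylinderEvent E₀ E₀) := by
  refine tendsto_nhds_unique (hP.tendsto_cylinder _ _) ?_
  have h : ∀ N : ℕ, (rcFreeBoxMeasure p q N).real (pieceCylinderEvent (box 2 N)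
      (E₀.map (sym2Equiv (Site.signedPerm π ε)).toEmbedding)
        (E₀.map (sym2Equiv (Site.signedPerm π ε)).toEmbedding)) =
      (rcFreeBoxMeasure p q N).real (pieceCylinderEvent (box 2 N) E₀ E₀) := by
    intro N
    rw [rcFreeBoxMeasure]
    exact (rcMeasure_real_pieceCylinderEvent_self_eq_of_iso (zdSignedPermIso π ε)
      (mem_box_iff_signedPerm_symm_mem π ε N) hp hq E₀).symm
  simp_rw [h]
  exact hP.tendsto_cylinder E₀ E₀

/-- The inverse of the pair bijection of a signed coordinate permutation is that of the inverse
signed permutation. [folklore] -/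
theorem sym2Equiv_signedPerm_symm (π : Equiv.Perm (Fin 2)) (ε : Fin 2 → ℤˣ) :
    (sym2Equiv (Site.signedPerm π ε)).symm = sym2Equiv (Site.signedPerm π.symm (ε ∘ π)) := by
  rw [sym2Equiv_symm, Site.signedPerm_symm]

/-- **Grimmett 2006, Thm. (4.19)(b), symmetries of the box, free measure on `ℤ²`**: for
`p ∈ [0,1]`, `q > 0` and a free infinite-volume random-cluster limit `P`, the image of `P`
under the relabelling of configurations by a signed coordinate permutation
`x ↦ (i ↦ εᵢ x_{π⁻¹ i})` (the eight symmetries of the square fixing the origin) is `P`.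
[cite: Grimmett2006, Thm. (4.19)(b)] -/
theorem IsFreeRandomClusterLimit.map_relabel_signedPerm (hP : IsFreeRandomClusterLimit p q P)
    (hp : p ∈ Set.Icc (0 : ℝ) 1) (hq : 0 < q) (π : Equiv.Perm (Fin 2)) (ε : Fin 2 → ℤˣ) :
    P.map (BondConfig.relabel (sym2Equiv (Site.signedPerm π ε))) = P := by
  haveI := hP.isProbabilityMeasure
  haveI : IsProbabilityMeasure (P.map (BondConfig.relabel (sym2Equiv (Site.signedPerm π ε)))) :=
    Measure.isProbabilityMeasure_map (MeasurableEquiv.measurable _).aemeasurable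
  refine ext_of_cylinderEvent_self fun E₀ => ?_
  rw [MeasurableEquiv.map_apply, relabel_preimage_cylinderEvent, sym2Equiv_signedPerm_symm]
  have h := hP.measureReal_cylinderEvent_self_map_signedPerm hp hq π.symm (ε ∘ π) E₀
  rw [measureReal_def, measureReal_def,
    ENNReal.toReal_eq_toReal_iff' (measure_ne_top _ _) (measure_ne_top _ _)] at h
  exact h

/-- Applied form: `P{ω | σ ω ∈ A} = P(A)` for every event `A` and every signed coordinate
permutation `σ`. [cite: Grimmett2006, Thm. (4.19)(b)] -/
theorem IsFreeRandomClusterLimit.measure_preimage_relabel_signedPerm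
    (hP : IsFreeRandomClusterLimit p q P) (hp : p ∈ Set.Icc (0 : ℝ) 1) (hq : 0 < q)
    (π : Equiv.Perm (Fin 2)) (ε : Fin 2 → ℤˣ) (A : Set (BondConfig (Site 2))) :
    P (BondConfig.relabel (sym2Equiv (Site.signedPerm π ε)) ⁻¹' A) = P A := by
  conv_rhs => rw [← hP.map_relabel_signedPerm hp hq π ε]
  rw [MeasurableEquiv.map_apply]

/-- The relabelling by a signed coordinate permutation is measure preserving for `P`.
[cite: Grimmett2006, Thm. (4.19)(b)] -/
theorem IsFreeRandomClusterLimit.measurePreserving_relabel_signedPerm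
    (hP : IsFreeRandomClusterLimit p q P) (hp : p ∈ Set.Icc (0 : ℝ) 1) (hq : 0 < q)
    (π : Equiv.Perm (Fin 2)) (ε : Fin 2 → ℤˣ) :
    MeasurePreserving (BondConfig.relabel (sym2Equiv (Site.signedPerm π ε))) P P :=
  ⟨MeasurableEquiv.measurable _, hP.map_relabel_signedPerm hp hq π ε⟩

/-- Integrated form: `∫ f(σ ω) dP(ω) = ∫ f dP` for every `f` and every signed coordinate
permutation `σ`. [cite: Grimmett2006, Thm. (4.19)(b)] -/
theorem IsFreeRandomClusterLimit.integral_comp_relabel_signedPerm {E : Type*}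
    [NormedAddCommGroup E] [NormedSpace ℝ E] (hP : IsFreeRandomClusterLimit p q P)
    (hp : p ∈ Set.Icc (0 : ℝ) 1) (hq : 0 < q) (π : Equiv.Perm (Fin 2)) (ε : Fin 2 → ℤˣ)
    (f : BondConfig (Site 2) → E) :
    ∫ ω, f (BondConfig.relabel (sym2Equiv (Site.signedPerm π ε)) ω) ∂P = ∫ ω, f ω ∂P := by
  rw [← integral_map_equiv, hP.map_relabel_signedPerm hp hq π ε]

/-! ### At the self-dual point: the measure of DKLM's Corollary 10 -/

/-- **The measure `φ_{ℤ²,q}` of Cor. 10 is translation invariant**: at `p = p_sd(q)`, `q ≥ 1`,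
no side condition remains. [cite: Grimmett2006, Thm. (4.19)(b) and (6.9)] -/
theorem IsFreeRandomClusterLimit.map_relabel_shift_rcSelfDualPoint {q : ℝ} (hq : 1 ≤ q)
    {P : Measure (BondConfig (Site 2))} (hP : IsFreeRandomClusterLimit (rcSelfDualPoint q) q P)
    (v : Site 2) : P.map (BondConfig.relabel (sym2Equiv (Site.shift v))) = P :=
  hP.map_relabel_shift (rcSelfDualPoint_mem_Icc q) hq v

/-- **The measure `φ_{ℤ²,q}` of Cor. 10 is invariant under the symmetries of the square**
(signed coordinate permutations), `q > 0`. [cite: Grimmett2006, Thm. (4.19)(b) and (6.9)] -/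
theorem IsFreeRandomClusterLimit.map_relabel_signedPerm_rcSelfDualPoint {q : ℝ} (hq : 0 < q)
    {P : Measure (BondConfig (Site 2))} (hP : IsFreeRandomClusterLimit (rcSelfDualPoint q) q P)
    (π : Equiv.Perm (Fin 2)) (ε : Fin 2 → ℤˣ) :
    P.map (BondConfig.relabel (sym2Equiv (Site.signedPerm π ε))) = P :=
  hP.map_relabel_signedPerm (rcSelfDualPoint_mem_Icc q) hq π ε

/-- Integrated form at the self-dual point, `q ∈ [1,4]` (the range of Cor. 10): expectations
under `φ_{ℤ²,q}` are unchanged by shifting the configuration by a lattice vector.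
[cite: Grimmett2006, Thm. (4.19)(b); DuminilCopinKozlowskiLammersManolescu2026, Cor. 10 (the measure φ_{ℤ²,q})] -/
theorem IsFreeRandomClusterLimit.integral_comp_relabel_shift_rcSelfDualPoint {q : ℝ}
    (hq : q ∈ Set.Icc (1 : ℝ) 4) {P : Measure (BondConfig (Site 2))}
    (hP : IsFreeRandomClusterLimit (rcSelfDualPoint q) q P) (v : Site 2)
    (f : BondConfig (Site 2) → ℝ) :
    ∫ ω, f (BondConfig.relabel (sym2Equiv (Site.shift v)) ω) ∂P = ∫ ω, f ω ∂P :=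
  hP.integral_comp_relabel_shift (rcSelfDualPoint_mem_Icc q) hq.1 v f

end Invariance

end Literature.Probability.Percolation

end
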